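import Literature.AnabelianGeometry.SemiGraphs.TemperedReconstructionGraphHomProofs
import Literature.AnabelianGeometry.SemiGraphs.TemperedQuasiGeometricCompatible
import Literature.AnabelianGeometry.SemiGraphs.TemperedMaximalCompactProofs
import Literature.AnabelianGeometry.SemiGraphs.TemperedEdgeLikeDistinctOf
import HarnessLib

/-!
# Corollary 3.9 (b), GRAPH LEVEL, over the compatible reading of Definition 3.8 (proof-only)

Mochizuki, *Semi-graphs of anabelioids*, Publ. RIMS **42** (2006), §3, Cor. 3.9, proof p. 42
[cite: MochizukiSemiAnbd2006, Cor 3.9 p.42].  Packaging of `existsUnique_vertexMap_of_isQuasiGeometric`,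
`existsUnique_edgeMap_of_isQuasiGeometric` and `exists_semiGraphHom_of_isQuasiGeometric` for a
COMPATIBLY quasi-geometric `φ` (`IsCompatiblyQuasiGeometric`, ruling χ2): there is a morphism of the
underlying graphs `F : G → H` such that every verticial subgroup at `v` maps onto an open subgroup of
a verticial subgroup at `F v`, and every edge-like subgroup at `e` onto an open subgroup of an
edge-like subgroup at `F e` — modulo Thm. 3.7 (i), (iii) (Thm. 3.7 (ii), (iv) and `EdgeLikeDistinct`
being theorems of the tree modulo (i), (iii)).  This is the graph level of the twin step R2′
`QuasiGeometricGraphDataCompat`; the anabelioid level (vertex/edge homomorphisms and 2-cells) remains.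
Nothing here takes a side on [IUTchIII] Cor. 3.12; typed ≠ discharged.
-/

namespace Literature.AnabelianGeometry.SemiGraphs

namespace ProfiniteSemiGraph

universe u

variable {𝒢 ℋ : ProfiniteSemiGraph.{u}}

/-- **Cor. 3.9 (b), graph level, compatible reading**: a compatibly quasi-geometric `φ` determines a
morphism of underlying graphs carrying verticial (resp. edge-like) subgroups onto open subgroups of
verticial (resp. edge-like) subgroups at the image vertex (resp. edge).
[cite: MochizukiSemiAnbd2006, Cor 3.9 p.42] -/
theorem exists_semiGraphHom_of_isCompatiblyQuasiGeometric (h37i : VerticialInjective.{u})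
    (h37iii : CompactInVerticial.{u}) (h𝒢 : Cor39Hypotheses 𝒢) (hℋ : Cor39Hypotheses ℋ)
    (c𝒢 : TemperedPiChart 𝒢) (cℋ : TemperedPiChart ℋ) (φ : c𝒢.G →ₜ* cℋ.G)
    (hφ : IsCompatiblyQuasiGeometric φ) :
    ∃ F : SemiGraph.Hom 𝒢.graph ℋ.graph,
      (∀ (v : 𝒢.graph.Vertex) (K : Subgroup c𝒢.G), K ∈ verticialSubgroups c𝒢 v →
        ∃ K₂ ∈ verticialSubgroups cℋ (F.vertexMap v), MapsOntoOpenSubgroupOf φ.toMonoidHom K K₂) ∧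
      ∀ (e : 𝒢.graph.Edge) (L : Subgroup c𝒢.G), L ∈ edgeLikeSubgroups c𝒢 e →
        ∃ L₂ ∈ edgeLikeSubgroups cℋ (F.edgeMap e), MapsOntoOpenSubgroupOf φ.toMonoidHom L L₂ := by
  have h37iv : MaximalCompactIffVerticial.{u} :=
    maximalCompactIffVerticial_of_thm37 h37iii verticialDistinct_holds h37i
  have hED : EdgeLikeDistinct.{u} := edgeLikeDistinct_of h37iii verticialDistinct_holds h37i
  obtain ⟨fV, hfV, -⟩ := existsUnique_vertexMap_of_isQuasiGeometric h37i verticialDistinct_holds h37iv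
    h𝒢.thm37Hypotheses hℋ.thm37Hypotheses c𝒢 cℋ φ hφ.isQuasiGeometric
  obtain ⟨fE, hfE, -⟩ := existsUnique_edgeMap_of_isQuasiGeometric h37i h37iv hED h𝒢 hℋ c𝒢 cℋ φ
    hφ.isQuasiGeometric
  obtain ⟨F, hFV, hFE⟩ := exists_semiGraphHom_of_isQuasiGeometric h37i h37iii h37iv h𝒢 hℋ c𝒢 cℋ φ
    hφ.compat hfV hfE
  subst hFV hFE
  exact ⟨F, hfV, hfE⟩

end ProfiniteSemiGraph

end Literature.AnabelianGeometry.SemiGraphs
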